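import Summits.AtomisticToContinuum.Crystallization.Theorems.FluxTubeKeplerFloorGivesLayered
import Summits.AtomisticToContinuum.Crystallization.Theorems.FluxTubeKeplerFluxCellKeplerSingleScale
import Summits.AtomisticToContinuum.Crystallization.Theorems.FluxTubeKeplerFluxCellKeplerGoodSitesWindows
import Summits.AtomisticToContinuum.Crystallization.Theorems.ChessboardParticlePlanesPeriodicWindowsIffCrystallization
import Summits.AtomisticToContinuum.Crystallization.Theorems.FluxTubeKeplerKeplerEnergyFloor

/-!
# Line `CompetitorBlindRung` — the PERIODIC-COMPETITOR ladder `CompRung m L ρ` over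
# `FluxTubeKepler.FloorGivesLayered` (forward rung G1, gen 8; crux `FluxCellKepler`, stmt-AtomisticToContinuum-15221)

Floor (proved, `FluxTubeKeplerFloorGivesLayered.FloorGivesLayered_proof`, stmt-AtomisticToContinuum-15223):
FLOOR(P₀) + a defect BUDGET pricing, at every scale `(R, η)`, EVERY site whose `R`-neighbourhood is not
two-way `η`-matched with a relaxed layered (Barlow) set force layered — hence periodic
(`PeriodicGivenLayered_holds`) — windows along every Lennard-Jones ground-state sequence.

ONE MOVE (template family enlarged OUTSIDE the layered world): at scale `(R, η)` a site is ALSO left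
un-priced when its `R`-neighbourhood is two-way `η`-matched with a PERIODIC point set of bounded
complexity — at most `m` points per cell, a cell basis of vectors of norm `≤ L`, points `ρ`-separated
(`PerGood m L ρ`).  `CompRung 0 L ρ` is the floor verbatim (no periodic set has `0` points per cell,
`compRung_zero`); enlarging `(m, L)` / shrinking `ρ` un-prices more (`compRung_anti`); the rung filed is the
top of the family, `CompetitorBlindRung := ∀ m L ρ, 0 < ρ → CompRung m L ρ`: "a Kepler-type certificate
need not charge a site that looks like ANY bounded-complexity periodic crystal — bcc, A15, Laves, simple
cubic, any periodic Barlow stacking at any density — and Lennard-Jones ground states still crystallize".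
The sub-problem `Crystallization` is indifferent to WHICH periodic structure appears
(`IsCrystallizing`: some periodic local limit), so the move realigns the budget with the Statement:
`Crystallization → CompetitorBlindRung` (`CompetitorBlindRung_of_Crystallization`, landed
`periodicWindows_of_crystallization`).

Why the floor's proof stops (seed file, Step 1 `eventually_exists_not_bad` l.74–107 feeds Step 2
`spacing_selection` l.163–229 ONLY layered-good sites): with the enlarged un-priced class the counting
step yields, eventually in `N`, a site that is layered-good OR periodic-good; in the second case there is
no spacing in `[47/50, 1]` to select and no Hägg datum to dilate — `spacing_selection` / `match_dilate` /
`PeriodicGivenLayered` have nothing to act on.  New idea: a SCALE-WISE TYPE DICHOTOMY (either layered-good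
sites persist at every scale — then the floor's Steps 2–3, landed as
`FluxCellKeplerSketch.stub_layeredWindowsOfGoodSites`, apply — or from some scale on only periodic-good
sites remain at every finer scale) + MAHLER-TYPE COMPACTNESS of bounded-complexity cell data modulo
nothing (rotations are absorbed in the basis) in the local two-way topology (`Sig.stub_cellCompact`) +
the diagonal selection of ONE limit cell serving every scale (`Sig.stub_perWindows`) + the construction of
a `PeriodicConfiguration 3` from a cell datum (`periodicOfCell`, proved here).  No Lennard-Jones input
beyond the floor's: the rung is potential-free above FLOOR + BUDGET.
-/

noncomputable section

namespace Summit.AtomisticToContinuum.Crystallization.Cruxes.FluxCellKepler.CompetitorLadder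

open Filter Topology
open Literature.MathematicalPhysics.StatisticalMechanics
open Summit.AtomisticToContinuum.Crystallization.Theorems.FluxCellKeplerSingleScale (LayeredGood)

local notation "E3" => EuclideanSpace ℝ (Fin 3)

/-! ## Definitions -/

/-- FLOOR(P₀): `N·e(P₀) ≤ E(x)` for every Lennard-Jones ground state `x` (verbatim the first hypothesis
of `FluxTubeKepler.FloorGivesLayered`). -/
def Floor (P₀ : PeriodicConfiguration 3) : Prop :=
  ∀ (N : ℕ) (x : Fin N → E3), IsGroundState lennardJones x →
    (N : ℝ) * P₀.energyPerParticle lennardJones ≤ interactionEnergy lennardJones x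

/-- The point set `F + ℤb₀ + ℤb₁ + ℤb₂` generated by a CELL DATUM `(b, F)` (cell basis `b`, motif `F`). -/
def cellSet (b : Fin 3 → E3) (F : Finset E3) : Set E3 :=
  {p | ∃ y ∈ F, ∃ n : Fin 3 → ℤ, p = y + ∑ k, (n k : ℝ) • b k}

/-- ADMISSIBLE CELL DATA of complexity `(m, L, ρ)`: `b` linearly independent with `‖b k‖ ≤ L`, a
non-empty motif of at most `m` points of norm `≤ 3L`, pairwise inequivalent modulo `ℤb`, and the generated
point set `ρ`-separated.  (Every periodic point set with `≤ m` points per cell, a cell basis of norms `≤ L`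
and separation `ρ` is `cellSet b F` for such a datum: reduce the motif into the cell.) -/
def IsCell (m : ℕ) (L ρ : ℝ) (b : Fin 3 → E3) (F : Finset E3) : Prop :=
  LinearIndependent ℝ b ∧ (∀ k, ‖b k‖ ≤ L) ∧ F.Nonempty ∧ F.card ≤ m ∧ (∀ y ∈ F, ‖y‖ ≤ 3 * L) ∧
    (∀ y ∈ F, ∀ y' ∈ F, (∃ n : Fin 3 → ℤ, y - y' = ∑ k, (n k : ℝ) • b k) → y = y') ∧
    (∀ p ∈ cellSet b F, ∀ q ∈ cellSet b F, p ≠ q → ρ ≤ dist p q)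

/-- Site `i` of `x` is `(R, η)`-PERIODIC-GOOD at complexity `(m, L, ρ)`: the relative positions
`x j − x i` are two-way `η`-matched on the `R`-ball with the point set of an admissible cell datum. -/
def PerGood (m : ℕ) (L ρ R η : ℝ) {N : ℕ} (x : Fin N → E3) (i : Fin N) : Prop :=
  ∃ (b : Fin 3 → E3) (F : Finset E3), IsCell m L ρ b F ∧
    (∀ p ∈ cellSet b F, ‖p‖ ≤ R → ∃ j : Fin N, dist (x j - x i) p ≤ η) ∧
    (∀ j : Fin N, ‖x j - x i‖ ≤ R → ∃ p ∈ cellSet b F, dist (x j - x i) p ≤ η)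

/-- COMPETITOR-BLIND BUDGET(P₀) at complexity `(m, L, ρ)`: at scale `(R, η)` only the sites that are
NEITHER layered-good NOR periodic-good are priced (the crux's quantifier order `∀ R η ∃ c`). -/
def Budget (m : ℕ) (L ρ : ℝ) (P₀ : PeriodicConfiguration 3) : Prop :=
  ∀ R η : ℝ, 0 < R → 0 < η → ∃ c : ℝ, 0 < c ∧
    ∀ (N : ℕ) (x : Fin N → E3), IsGroundState lennardJones x →
      c * (Nat.card {i : Fin N // ¬ (LayeredGood R η x i ∨ PerGood m L ρ R η x i)} : ℝ) ≤
        interactionEnergy lennardJones x - (N : ℝ) * P₀.energyPerParticle lennardJones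

/-- Periodic windows along `x` (verbatim the conclusion of `ChessboardParticlePlanes.PeriodicWindows`). -/
def HasPeriodicWindows (x : (N : ℕ) → (Fin N → E3)) : Prop :=
  ∃ P : PeriodicConfiguration 3, ∀ R ε : ℝ, 0 < ε → ∃ᶠ N in atTop, ∃ t : E3,
    (∀ s ∈ P.points, ‖s‖ ≤ R → ∃ i : Fin N, dist (x N i + t) s ≤ ε) ∧
    (∀ i : Fin N, ‖x N i + t‖ ≤ R → ∃ s ∈ P.points, dist (x N i + t) s ≤ ε)

/-- The graded family: FLOOR + the competitor-blind budget of complexity `(m, L, ρ)` force periodic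
windows along every Lennard-Jones ground-state sequence. -/
def CompRung (m : ℕ) (L ρ : ℝ) : Prop :=
  ∀ P₀ : PeriodicConfiguration 3, Floor P₀ → Budget m L ρ P₀ →
    ∀ x : (N : ℕ) → (Fin N → E3), (∀ N, IsGroundState lennardJones (x N)) → HasPeriodicWindows x

/-- **The deciding rung** (top of the family): periodic competitors of EVERY bounded complexity go
un-priced, and Lennard-Jones ground states still have periodic windows. -/
def CompetitorBlindRung : Prop := ∀ (m : ℕ) (L ρ : ℝ), 0 < ρ → CompRung m L ρ

/-! ## Dial monotonicity -/

theorem isCell_mono {m m' : ℕ} {L L' ρ ρ' : ℝ} (hm : m ≤ m') (hL : L ≤ L') (hρ : ρ' ≤ ρ)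
    {b : Fin 3 → E3} {F : Finset E3} : IsCell m L ρ b F → IsCell m' L' ρ' b F := by
  rintro ⟨hli, hb, hne, hcard, hF, hinj, hsep⟩
  exact ⟨hli, fun k => (hb k).trans hL, hne, hcard.trans hm, fun y hy => (hF y hy).trans (by linarith),
    hinj, fun p hp q hq hpq => hρ.trans (hsep p hp q hq hpq)⟩

theorem perGood_mono {m m' : ℕ} {L L' ρ ρ' : ℝ} (hm : m ≤ m') (hL : L ≤ L') (hρ : ρ' ≤ ρ)
    {R η : ℝ} {N : ℕ} {x : Fin N → E3} {i : Fin N} :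
    PerGood m L ρ R η x i → PerGood m' L' ρ' R η x i := by
  rintro ⟨b, F, hc, h₁, h₂⟩
  exact ⟨b, F, isCell_mono hm hL hρ hc, h₁, h₂⟩

/-- A budget pricing the larger set prices the smaller one. -/
theorem budget_mono {m m' : ℕ} {L L' ρ ρ' : ℝ} (hm : m ≤ m') (hL : L ≤ L') (hρ : ρ' ≤ ρ)
    (P₀ : PeriodicConfiguration 3) : Budget m L ρ P₀ → Budget m' L' ρ' P₀ := by
  classical
  intro hB R η hR hη
  obtain ⟨c, hc, hcB⟩ := hB R η hR hη
  refine ⟨c, hc, fun N x hx => le_trans ?_ (hcB N x hx)⟩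
  have hle : Nat.card {i : Fin N // ¬ (LayeredGood R η x i ∨ PerGood m' L' ρ' R η x i)} ≤
      Nat.card {i : Fin N // ¬ (LayeredGood R η x i ∨ PerGood m L ρ R η x i)} := by
    rw [Nat.card_eq_fintype_card, Nat.card_eq_fintype_card]
    exact Fintype.card_subtype_mono _ _ fun i hi h => hi (h.imp_right (perGood_mono hm hL hρ))
  exact mul_le_mul_of_nonneg_left (by exact_mod_cast hle) hc.le

/-- `CompRung` is ANTITONE in the un-priced family: enlarging `(m, L)` or shrinking `ρ` strengthens the
rung (harder-to-easier direction of the dial). -/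
theorem compRung_anti {m m' : ℕ} {L L' ρ ρ' : ℝ} (hm : m ≤ m') (hL : L ≤ L') (hρ : ρ' ≤ ρ) :
    CompRung m' L' ρ' → CompRung m L ρ :=
  fun H P₀ hF hB x hx => H P₀ hF (budget_mono hm hL hρ P₀ hB) x hx

/-! ## F3 — the family at `m = 0` is the proved floor -/

theorem not_isCell_zero {L ρ : ℝ} {b : Fin 3 → E3} {F : Finset E3} : ¬ IsCell 0 L ρ b F := by
  rintro ⟨-, -, hne, hcard, -⟩
  have := Finset.card_pos.2 hne
  omega

theorem not_perGood_zero {L ρ R η : ℝ} {N : ℕ} (x : Fin N → E3) (i : Fin N) :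
    ¬ PerGood 0 L ρ R η x i := by
  rintro ⟨b, F, hc, -⟩
  exact not_isCell_zero hc

/-- **F3.** `CompRung 0 L ρ` — no periodic competitor un-priced — is the seed `FloorGivesLayered_proof`
followed by the proved `PeriodicGivenLayered_holds`. [folklore] -/
theorem compRung_zero (L ρ : ℝ) : CompRung 0 L ρ := by
  classical
  intro P₀ hF hB x hx
  refine Theses.FluxTubeKepler.PeriodicGivenLayered_holds x hx
    (Theorems.FluxTubeKeplerFloorGivesLayered.FloorGivesLayered_proof P₀ hF ?_ x hx)
  intro R η hR hη
  obtain ⟨c, hc, hcB⟩ := hB R η hR hη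
  refine ⟨c, hc, fun N y hy => ?_⟩
  show c * (Nat.card {i : Fin N // ¬ LayeredGood R η y i} : ℝ) ≤ _
  have hcard : Nat.card {i : Fin N // ¬ (LayeredGood R η y i ∨ PerGood 0 L ρ R η y i)} =
      Nat.card {i : Fin N // ¬ LayeredGood R η y i} :=
    Nat.card_congr (Equiv.subtypeEquivRight fun i => by simp [not_perGood_zero])
  rw [← hcard]
  exact hcB N y hy

example (L ρ : ℝ) : CompRung 0 L ρ := compRung_zero L ρ

/-- Every member above the floor gives the floor member back (the dial is antitone). -/
theorem compRung_zero_of_competitorBlindRung (h : CompetitorBlindRung) (L ρ : ℝ) (hρ : 0 < ρ) :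
    CompRung 0 L ρ :=
  compRung_anti (Nat.zero_le 1) le_rfl le_rfl (h 1 L ρ hρ)

/-! ## F4 — on path: `Crystallization → CompetitorBlindRung` -/

/-- Every member of the family follows from the sub-problem (landed `periodicWindows_of_crystallization`):
its FLOOR and BUDGET hypotheses are simply not used. [folklore] -/
theorem compRung_of_crystallization (m : ℕ) (L ρ : ℝ) (h : _root_.Crystallization) : CompRung m L ρ :=
  fun _ _ _ x hx =>
    (Theorems.ChessboardParticlePlanesPeriodicWindowsIffCrystallization.periodicWindows_of_crystallization
      h) x hx

/-- **F4 (on path).** `Crystallization → CompetitorBlindRung`. [folklore] -/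
@[aesop safe apply]
theorem CompetitorBlindRung_of_Crystallization (h : _root_.Crystallization) : CompetitorBlindRung :=
  fun m L ρ _ => compRung_of_crystallization m L ρ h

/-! ## Support (proved): a cell datum generates a periodic configuration -/

theorem layeredGood_mono₂ {R R' η η' : ℝ} (hR : R ≤ R') (hη : η' ≤ η) {N : ℕ} (x : Fin N → E3)
    (i : Fin N) : LayeredGood R' η' x i → LayeredGood R η x i := by
  rintro ⟨a, ha₁, ha₂, A, s, z, hs, hz, h₁, h₂⟩
  refine ⟨a, ha₁, ha₂, A, s, z, hs, hz, fun p hp hpR => ?_, fun j hj => ?_⟩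
  · obtain ⟨j, hj⟩ := h₁ p hp (hpR.trans hR)
    exact ⟨j, hj.trans hη⟩
  · obtain ⟨p, hp, hd⟩ := h₂ j (hj.trans hR)
    exact ⟨p, hp, hd.trans hη⟩

/-- **A cell datum is a periodic configuration.** For admissible `(b, F)` the structure with lattice
`ℤb` (a full-rank discrete `ℤ`-lattice, `b` being a basis of `ℝ³`) and motif `F` is a
`PeriodicConfiguration 3` whose point set is `cellSet b F`. [folklore] -/
theorem periodicOfCell {m : ℕ} {L ρ : ℝ} {b : Fin 3 → E3} {F : Finset E3} (h : IsCell m L ρ b F) :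
    ∃ P : PeriodicConfiguration 3, P.points = cellSet b F := by
  classical
  obtain ⟨hli, -, hne, -, -, hinj, -⟩ := h
  have hcard : Fintype.card (Fin 3) = Module.finrank ℝ E3 := by simp
  let B : Module.Basis (Fin 3) ℝ E3 := basisOfLinearIndependentOfCardEqFinrank hli hcard
  have hB : ⇑B = b := coe_basisOfLinearIndependentOfCardEqFinrank hli hcard
  have hsum : ∀ c : Fin 3 → ℤ, ∑ k, c k • B k = ∑ k, (c k : ℝ) • b k := fun c =>
    Finset.sum_congr rfl fun k _ => by rw [hB, Int.cast_smul_eq_zsmul]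
  refine ⟨{ lattice := Submodule.span ℤ (Set.range ⇑B), discrete := inferInstance,
            isZLattice := inferInstance, motif := F, motif_nonempty := hne,
            eq_of_sub_mem := ?_ }, ?_⟩
  · intro y hy y' hy' hmem
    obtain ⟨c, hc⟩ := (Submodule.mem_span_range_iff_exists_fun ℤ).1 hmem
    exact hinj y hy y' hy' ⟨c, by rw [← hc, hsum]⟩
  · ext p
    simp only [PeriodicConfiguration.points, cellSet, Set.mem_setOf_eq]
    constructor
    · rintro ⟨y, hy, g, hg, rfl⟩
      obtain ⟨c, hc⟩ := (Submodule.mem_span_range_iff_exists_fun ℤ).1 hg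
      exact ⟨y, hy, c, by rw [← hc, hsum]⟩
    · rintro ⟨y, hy, n, rfl⟩
      exact ⟨y, hy, ∑ k, (n k : ℝ) • b k,
        by rw [← hsum]; exact (Submodule.mem_span_range_iff_exists_fun ℤ).2 ⟨n, rfl⟩, rfl⟩


/-! ## The line: two registered stubs and the rung BY NAME (sorry-free composition)

The rung is potential-free above FLOOR + BUDGET.  Step 1 of the floor (`eventually_exists_not_bad`, landed
for an arbitrary site predicate) gives, at every scale and eventually in `N`, a site that is layered-good
OR periodic-good.  SCALE-WISE TYPE DICHOTOMY: either (A) layered-good sites occur frequently in `N` at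
EVERY scale — then the floor's Steps 2–3, landed as `FluxCellKeplerSketch.stub_layeredWindowsOfGoodSites`,
and the proved `PeriodicGivenLayered` give periodic windows; or (B) at some scale `(R₁, η₁)` layered-good
sites eventually disappear, hence (monotonicity of goodness in the scale) at every FINER scale the
un-priced site is periodic-good: cell compactness (`stub_cellCompact`) and the diagonal selection
(`stub_perWindows`) produce ONE admissible cell datum carrying windows at every scale, and
`periodicOfCell` turns it into the periodic configuration of `HasPeriodicWindows`. -/

/-- Two-way `ε`-closeness of two point sets on the `R`-ball. -/
def Close (ε R : ℝ) (S T : Set E3) : Prop :=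
  (∀ p ∈ S, ‖p‖ ≤ R → ∃ q ∈ T, dist p q ≤ ε) ∧ (∀ q ∈ T, ‖q‖ ≤ R → ∃ p ∈ S, dist q p ≤ ε)

/-- CELL COMPACTNESS at complexity `(m, L, ρ)`: every sequence of admissible cell data has a subsequence
whose point sets converge, two-way on every ball, to the point set of an ADMISSIBLE cell datum (the limit
basis stays linearly independent and the limit motif inequivalent and separated BECAUSE the point sets are
uniformly `ρ`-separated — Mahler's compactness criterion in elementary dress; rotations need no quotient,
they are absorbed in the basis). -/
def CellCompact (m : ℕ) (L ρ : ℝ) : Prop :=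
  ∀ (b : ℕ → Fin 3 → E3) (F : ℕ → Finset E3), (∀ k, IsCell m L ρ (b k) (F k)) →
    ∃ (φ : ℕ → ℕ) (b' : Fin 3 → E3) (F' : Finset E3), StrictMono φ ∧ IsCell m L ρ b' F' ∧
      ∀ R ε : ℝ, 0 < ε → ∀ᶠ k in atTop, Close ε R (cellSet (b (φ k)) (F (φ k))) (cellSet b' F')

namespace Sig

/-- STUB 1 (load-bearing, potential-free, size L): admissible cell data of every complexity with `ρ > 0`
are sequentially compact in the local two-way topology, with admissible limits. -/
def stub_cellCompact : Prop := ∀ (m : ℕ) (L ρ : ℝ), 0 < ρ → CellCompact m L ρ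

/-- STUB 2 (the diagonal, potential-free, size M): under cell compactness, periodic-good sites frequently
in `N` at every fine scale `(R ≥ R₁, η ≤ η₁)` — with `N`- and scale-dependent cell data — give two-way
windows on the point set of ONE admissible cell datum at every scale (diagonal over the scales, a late
index of the convergent subsequence, translation `t := −x N i`, radius read at `R + 1`). -/
def stub_perWindows : Prop := ∀ (m : ℕ) (L ρ : ℝ), 0 < ρ → CellCompact m L ρ →
  ∀ x : (N : ℕ) → (Fin N → E3), ∀ R₁ η₁ : ℝ, 0 < η₁ →
    (∀ R η : ℝ, R₁ ≤ R → 0 < η → η ≤ η₁ → ∃ᶠ N in atTop, ∃ i : Fin N, PerGood m L ρ R η (x N) i) →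
    ∃ (b : Fin 3 → E3) (F : Finset E3), IsCell m L ρ b F ∧
      ∀ R ε : ℝ, 0 < ε → ∃ᶠ N in atTop, ∃ t : E3,
        (∀ s ∈ cellSet b F, ‖s‖ ≤ R → ∃ i : Fin N, dist (x N i + t) s ≤ ε) ∧
        (∀ i : Fin N, ‖x N i + t‖ ≤ R → ∃ s ∈ cellSet b F, dist (x N i + t) s ≤ ε)

end Sig

/-- Registered stub 1: cell compactness. [conjecture] -/
theorem stub_cellCompact : Sig.stub_cellCompact := by
  sorry

/-- Registered stub 2: periodic selection (the diagonal). [conjecture] -/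
theorem stub_perWindows : Sig.stub_perWindows := by
  sorry

open Summit.AtomisticToContinuum.Crystallization.Theorems.FluxTubeKeplerFloorGivesLayered
  (eventually_exists_not_bad) in
/-- **Assembly (sorry-free).** `stub_cellCompact → stub_perWindows → CompetitorBlindRung`: counting
(landed Step 1 of the floor) + scale-wise type dichotomy + (A) the landed Steps 2–3 and the proved
`PeriodicGivenLayered`, or (B) cell compactness, the diagonal, and `periodicOfCell`. -/
theorem CompetitorBlindRung_of (h₁ : Sig.stub_cellCompact) (h₂ : Sig.stub_perWindows) :
    CompetitorBlindRung := by
  intro m L ρ hρ P₀ hF hB x hx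
  classical
  -- Step 1: at every scale, eventually in `N`, an un-priced site (layered-good or periodic-good)
  have hev : ∀ R η : ℝ, 0 < R → 0 < η → ∀ᶠ N in atTop,
      ∃ i : Fin N, LayeredGood R η (x N) i ∨ PerGood m L ρ R η (x N) i := by
    intro R η hR hη
    obtain ⟨c, hc, hcN⟩ := hB R η hR hη
    have h := eventually_exists_not_bad P₀ hF
      (bad := fun N y i => ¬ (LayeredGood R η y i ∨ PerGood m L ρ R η y i)) hc hcN
    exact h.mono fun N hN => by
      obtain ⟨i, hi⟩ := hN (x N) (hx N)
      exact ⟨i, not_not.1 hi⟩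
  -- Step 2: scale-wise type dichotomy
  by_cases hA : ∀ R η : ℝ, 0 < R → 0 < η → ∃ᶠ N in atTop, ∃ i : Fin N, LayeredGood R η (x N) i
  · -- (A) layered-good sites persist at every scale: the floor's Steps 2–3 (landed) and PGL
    exact Theses.FluxTubeKepler.PeriodicGivenLayered_holds x hx
      (Theorems.FluxCellKeplerSketch.stub_layeredWindowsOfGoodSites x hA)
  · -- (B) from some scale on, only periodic-good sites remain at every finer scale
    simp only [not_forall, Filter.not_frequently, not_exists] at hA
    obtain ⟨R₁, η₁, hR₁, hη₁, hno⟩ := hA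
    have hper : ∀ R η : ℝ, R₁ ≤ R → 0 < η → η ≤ η₁ →
        ∃ᶠ N in atTop, ∃ i : Fin N, PerGood m L ρ R η (x N) i := by
      intro R η hR hη hηη
      refine (((hev R η (hR₁.trans_le hR) hη).and hno).mono fun N hN => ?_).frequently
      obtain ⟨⟨i, hi⟩, hno'⟩ := hN
      rcases hi with hi | hi
      · exact absurd (layeredGood_mono₂ hR hηη (x N) i hi) (hno' i)
      · exact ⟨i, hi⟩
    obtain ⟨b, F, hcell, hwin⟩ := h₂ m L ρ hρ (h₁ m L ρ hρ) x R₁ η₁ hη₁ hper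
    obtain ⟨P, hP⟩ := periodicOfCell hcell
    exact ⟨P, fun R ε hε => by rw [hP]; exact hwin R ε hε⟩

/-- **The closed skeleton instance**: the rung by name from the two declared stubs (the only `sorry`s
of this file enter here). [conjecture] -/
theorem CompetitorBlindRung_skeleton : CompetitorBlindRung :=
  CompetitorBlindRung_of stub_cellCompact stub_perWindows

/-! ## How the rung relieves the crux `FluxCellKepler` (stmt-AtomisticToContinuum-15221) -/

/-- The competitor-blind Kepler floor of complexity `(m, L, ρ)`: some periodic `P₀` with FLOOR and the
competitor-blind BUDGET. -/
def CompKeplerFloor (m : ℕ) (L ρ : ℝ) : Prop :=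
  ∃ P₀ : PeriodicConfiguration 3, Floor P₀ ∧ Budget m L ρ P₀

theorem compKeplerFloor_mono {m m' : ℕ} {L L' ρ ρ' : ℝ} (hm : m ≤ m') (hL : L ≤ L') (hρ : ρ' ≤ ρ) :
    CompKeplerFloor m L ρ → CompKeplerFloor m' L' ρ' := by
  rintro ⟨P₀, hF, hB⟩
  exact ⟨P₀, hF, budget_mono hm hL hρ P₀ hB⟩

/-- Rung + competitor-blind Kepler floor ⇒ periodic windows along every ground-state sequence (whence
`Crystallization` by the landed `crystallization_of_periodicWindows`; the composition with the sub-problem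
constant is deliberately not restated here). -/
theorem windows_of_compRung {m : ℕ} {L ρ : ℝ} (h : CompRung m L ρ) (hK : CompKeplerFloor m L ρ) :
    ∀ x : (N : ℕ) → (Fin N → E3), (∀ N, IsGroundState lennardJones (x N)) → HasPeriodicWindows x := by
  obtain ⟨P₀, hF, hB⟩ := hK
  exact fun x hx => h P₀ hF hB x hx

/-- The crux as filed gives the complexity-`0` Kepler floor (landed bookkeeping `KeplerEnergyFloor` +
the proved minimal distance), hence every competitor-blind one: the rung asks STRICTLY LESS of the
certificate — sites resembling any bounded-complexity periodic crystal need not be charged. -/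
theorem compKeplerFloor_of_fluxCellKepler (hK : Theses.FluxTubeKepler.FluxCellKepler) (m : ℕ) (L ρ : ℝ) :
    CompKeplerFloor m L ρ := by
  classical
  obtain ⟨P₀, hF, hB⟩ :=
    Theorems.keplerEnergyFloor_proof hK LennardJonesMinimalDistance_holds
  refine compKeplerFloor_mono (Nat.zero_le m) le_rfl le_rfl ⟨P₀, hF, fun R η hR hη => ?_⟩
  obtain ⟨c, hc, hcB⟩ := hB R η hR hη
  refine ⟨c, hc, fun N y hy => ?_⟩
  have hcard : Nat.card {i : Fin N // ¬ (LayeredGood R η y i ∨ PerGood 0 L ρ R η y i)} =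
      Nat.card {i : Fin N // ¬ LayeredGood R η y i} :=
    Nat.card_congr (Equiv.subtypeEquivRight fun i => by simp [not_perGood_zero])
  rw [hcard]
  exact hcB N y hy

end Summit.AtomisticToContinuum.Crystallization.Cruxes.FluxCellKepler.CompetitorLadder

end
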